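import Mathlib
import Summits.Ventures.PercRepro2.Defs
import Summits.Ventures.PercRepro2.Independence
import Summits.Ventures.PercRepro2.Harris
import Summits.Ventures.PercRepro2.Graph
import Summits.Ventures.PercRepro2.Exploration
import Summits.Ventures.PercRepro2.Events
import Summits.Ventures.PercRepro2.Induced
import Summits.Ventures.PercRepro2.BHKEvents
import Summits.Ventures.PercRepro2.BHKAvoid
import Summits.Ventures.PercRepro2.ZCPendantSecondOrder
import Summits.Ventures.PercRepro2.CDRequired
import Summits.Ventures.PercRepro2.CCTRootEdge
import Summits.Ventures.PercRepro2.OneEdge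
import Summits.Ventures.PercRepro2.OneRootDropMono

/-!
# The first nested pair of routes — the lemmas (blind cell PercRepro2, mine-a g34; MINE-A.md §89.7)

Helpers for `CDNestedEdge.cd_of_edge_and_path` (row 2′CD when under `Q` the only `a₁–a₃` routes are the
edge `ε = {a₁, a₃}` and the path `b₁ = {a₁, y}`, `b₂ = {y, a₃}`): the two-world decomposition of a mass
(`prob_inter_two_worlds`), the internal-edge lemma (with `b₁, b₂` open, the state of `ε` changes no
connection: `conn_update_ε_iff`), the reading of `Q` as an avoidance event once `ε` (and `b₁`) are pinned
open (`Q_iff_avoid_pair`, `Q_iff_avoid_triple`), and the pinning identities for two and three pins.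
No definition; one seat.
-/

namespace Summit.Ventures.PercRepro2

namespace CDNestedEdge

section Decomp

variable {E : Type*} [Fintype E] [DecidableEq E] {R : Type*} [CommRing R]

/-- **The two-world decomposition of a mass**: for `ε ∉ {b₁, b₂}`, `b₁ ≠ b₂`,
`P_p(X ∩ ({ε open} ∪ {b₁, b₂ open})) = p_ε P_{p[ε↦1]}(X) + (1 − p_ε) p_{b₁} p_{b₂} P_{p[ε↦0,b₁↦1,b₂↦1]}(X)`. -/
lemma prob_inter_two_worlds (p : E → R) (X : Set (Config E)) {ε b₁ b₂ : E} (h1 : b₁ ≠ ε)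
    (h2 : b₂ ≠ ε) (h12 : b₂ ≠ b₁) :
    prob p (X ∩ (openEdge ε ∪ (openEdge b₁ ∩ openEdge b₂))) =
      p ε * prob (Function.update p ε 1) X +
        (1 - p ε) * p b₁ * p b₂ *
          prob (Function.update (Function.update (Function.update p ε 0) b₁ 1) b₂ 1) X := by
  have hsplit : X ∩ (openEdge ε ∪ (openEdge b₁ ∩ openEdge b₂)) =
      (X ∩ openEdge ε) ∪ ((X ∩ openEdge b₂ ∩ openEdge b₁) ∩ closedEdge ε) := by
    ext ω
    simp only [Set.mem_inter_iff, Set.mem_union, openEdge, closedEdge, Set.mem_setOf_eq]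
    cases h : ω ε
    · simp; tauto
    · simp
  have hdisj : Disjoint (X ∩ openEdge ε) ((X ∩ openEdge b₂ ∩ openEdge b₁) ∩ closedEdge ε) := by
    rw [Set.disjoint_left]
    rintro ω ⟨_, hε⟩ ⟨_, hε'⟩
    simp only [openEdge, closedEdge, Set.mem_setOf_eq] at hε hε'
    rw [hε] at hε'
    exact Bool.true_eq_false.mp hε' |>.elim
  rw [hsplit, prob_union_of_disjoint p hdisj, prob_inter_openEdge, prob_inter_closedEdge,
    prob_inter_openEdge, prob_inter_openEdge]
  simp only [Function.update_of_ne h1, Function.update_of_ne h2, Function.update_of_ne h12]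
  ring

end Decomp

section Main

variable {V : Type*} {E : Type*} [Fintype E] [DecidableEq E] [Fintype V] [DecidableEq V]
  {R : Type*} [Field R] [LinearOrder R] [IsStrictOrderedRing R]

variable {ends : E → Sym2 V} {ε b₁ b₂ : E} {a₁ a₃ y : V}

omit [Fintype E] [Fintype V] [DecidableEq V] in
/-- With `b₁ = {a₁, y}` and `b₂ = {y, a₃}` open, the vertices `a₁, a₃` are connected, so opening or
closing `ε = {a₁, a₃}` changes no connection: `Conn ω[ε ↦ true] u w ↔ Conn ω[ε ↦ false] u w`. -/
lemma conn_update_ε_iff (hε : ends ε = s(a₁, a₃)) (hb₁ : ends b₁ = s(a₁, y))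
    (hb₂ : ends b₂ = s(y, a₃)) (h1 : b₁ ≠ ε) (h2 : b₂ ≠ ε) (ω : Config E) (hω₁ : ω b₁ = true)
    (hω₂ : ω b₂ = true) (u w : V) :
    Conn ends (Function.update ω ε true) u w ↔ Conn ends (Function.update ω ε false) u w := by
  have h13 : Conn ends (Function.update ω ε false) a₁ a₃ := by
    have e1 : OpenAdj ends (Function.update ω ε false) a₁ y :=
      ⟨b₁, by rw [Function.update_of_ne h1]; exact hω₁, hb₁⟩
    have e2 : OpenAdj ends (Function.update ω ε false) y a₃ :=
      ⟨b₂, by rw [Function.update_of_ne h2]; exact hω₂, hb₂⟩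
    exact conn_trans (conn_of_openAdj e1) (conn_of_openAdj e2)
  have key := OneEdge.conn_update_true_iff hε (Function.update ω ε false) u w
  rw [Function.update_idem] at key
  rw [key]
  constructor
  · rintro (h | ⟨hu, hw⟩ | ⟨hu, hw⟩)
    · exact h
    · exact conn_trans hu (conn_trans h13 hw)
    · exact conn_trans hu (conn_trans (conn_symm h13) hw)
  · intro h
    exact Or.inl h

omit [Fintype E] [DecidableEq E] [Fintype V] [DecidableEq V] in
/-- Configurations with the same connections have the same cluster. -/
lemma cluster_eq_of_conn_iff {ω ω' : Config E} (h : ∀ u w, Conn ends ω u w ↔ Conn ends ω' u w)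
    (v : V) : cluster ends ω v = cluster ends ω' v := by
  ext u; simp only [mem_cluster]; exact h v u

omit [Fintype E] [DecidableEq E] [Fintype V] in
/-- In a configuration with `ε = {a₁, a₃}` open, `{a₁ ↮ a₂}` is `{a₂ ↮ {a₁, a₃}}`. -/
lemma Q_iff_avoid_pair (hε : ends ε = s(a₁, a₃)) (a₂ : V) (ω : Config E) (hω : ω ε = true) :
    ¬ Conn ends ω a₁ a₂ ↔ ω ∈ avoidAll ends a₂ {a₁, a₃} := by
  have h13 : Conn ends ω a₁ a₃ := conn_of_openAdj ⟨ε, hω, hε⟩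
  rw [mem_avoidAll]
  constructor
  · intro hQ x hx hc
    simp only [Finset.mem_insert, Finset.mem_singleton] at hx
    rcases hx with rfl | rfl
    · exact hQ (conn_symm hc)
    · exact hQ (conn_trans h13 (conn_symm hc))
  · intro h hc
    exact h a₁ (by simp) (conn_symm hc)

omit [Fintype E] [DecidableEq E] [Fintype V] in
/-- In a configuration with `ε = {a₁, a₃}` and `b₁ = {a₁, y}` open, `{a₁ ↮ a₂}` is
`{a₂ ↮ {a₁, a₃, y}}`. -/
lemma Q_iff_avoid_triple (hε : ends ε = s(a₁, a₃)) (hb₁ : ends b₁ = s(a₁, y)) (a₂ : V)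
    (ω : Config E) (hω : ω ε = true) (hω₁ : ω b₁ = true) :
    ¬ Conn ends ω a₁ a₂ ↔ ω ∈ avoidAll ends a₂ {a₁, a₃, y} := by
  have h13 : Conn ends ω a₁ a₃ := conn_of_openAdj ⟨ε, hω, hε⟩
  have h1y : Conn ends ω a₁ y := conn_of_openAdj ⟨b₁, hω₁, hb₁⟩
  rw [mem_avoidAll]
  constructor
  · intro hQ x hx hc
    simp only [Finset.mem_insert, Finset.mem_singleton] at hx
    rcases hx with rfl | rfl | rfl
    · exact hQ (conn_symm hc)
    · exact hQ (conn_trans h13 (conn_symm hc))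
    · exact hQ (conn_trans h1y (conn_symm hc))
  · intro h hc
    exact h a₁ (by simp) (conn_symm hc)

omit [Fintype E] in
/-- A configuration is below itself with an edge opened. -/
lemma le_update_true (ω : Config E) (e : E) : ω ≤ Function.update ω e true := by
  intro e'
  by_cases h : e' = e
  · subst h; simp
  · simp [Function.update_of_ne h]

omit [Fintype V] [DecidableEq V] in
/-- Pinning an edge open shrinks an avoidance event. -/
lemma prob_update_one_avoid_le (p : E → R) (hp : IsProbVec p) (e : E) (a₂ : V) (S : Finset V) :
    prob (Function.update p e 1) (avoidAll ends a₂ S) ≤ prob p (avoidAll ends a₂ S) := by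
  rw [CCT.prob_update_one_eq]
  refine prob_mono hp fun ω hω => ?_
  simp only [Set.mem_setOf_eq] at hω
  intro x hx hc
  exact hω x hx (conn_mono (le_update_true ω e) hc)

omit [Fintype V] [DecidableEq V] [LinearOrder R] [IsStrictOrderedRing R] in
/-- Two pins: `P_{p[e↦1, e'↦1]}(A) = P_p({ω ∣ ω[e ↦ open][e' ↦ open] ∈ A})`. -/
lemma prob_update_two_eq (p : E → R) (e e' : E) (A : Set (Config E)) :
    prob (Function.update (Function.update p e 1) e' 1) A =
      prob p {ω | Function.update (Function.update ω e true) e' true ∈ A} := by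
  rw [CCT.prob_update_one_eq, CCT.prob_update_one_eq]
  rfl

omit [Fintype V] [DecidableEq V] [LinearOrder R] [IsStrictOrderedRing R] in
/-- Three pins. -/
lemma prob_update_three_eq (p : E → R) (e e' e'' : E) (A : Set (Config E)) :
    prob (Function.update (Function.update (Function.update p e 1) e' 1) e'' 1) A =
      prob p {ω | Function.update (Function.update (Function.update ω e true) e' true) e'' true ∈ A} := by
  rw [CCT.prob_update_one_eq, prob_update_two_eq]
  rfl

omit [Fintype V] [DecidableEq V] [LinearOrder R] [IsStrictOrderedRing R] in
/-- Two pins, the first closed. -/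
lemma prob_update_zero_two_eq (p : E → R) (e e' e'' : E) (A : Set (Config E)) :
    prob (Function.update (Function.update (Function.update p e 0) e' 1) e'' 1) A =
      prob p {ω | Function.update (Function.update (Function.update ω e false) e' true) e'' true ∈ A} := by
  rw [CCT.prob_update_one_eq, CCT.prob_update_one_eq, CCT.prob_update_zero_eq]
  rfl

end Main

end CDNestedEdge

end Summit.Ventures.PercRepro2
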